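import Summits.QuantumFields.YangMills.Theorems.LuscherReductionDressedRitzPolyakovLiftPScalingDressedBudgets
import HarnessLib

/-!
# Route `LuscherReduction`, item `DressedRitz` (stmt-QuantumFields-20205), line «polyakovlift» r7, stub S-PSCAL″ — F9 layer (D)+(C):
# the DRESSED LEVEL DATA of `PScal.pscaling_core` from ONE on the cluster windows (fleet seat ym-20205-polyakovlift-s1 gen 3, LEAD's wave-3 ask)

Support module (`--supports stmt-QuantumFields-20205`, helper, no closure claim).  The LEAD's assembly core `PScal.pscaling_core`
(`…PolyakovLiftPScalingAssembly.lean`) takes, besides the quasimode package (Q), a block (D) of «dressed level data at `n = L`» — numbers `σ, lamlow, Γ, τ` with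
hypotheses `hσ hlow0 hlow hΓ hτ0 hτ1 hup hlo' hgapτ` — and a block (C) «the final currency» — one constant `C` with `hτC : τ ≤ CΛ²/L` and `hΩC`.  This file produces
(D)+(C) from w1a's `PScal.levels_window` (ONE at coupling `B` on the windows `[winLo j, winHi j)` below a cluster end `K`), uniformly: the constants
`C₀` (side-condition threshold), `C` (final currency) and `B₁` are chosen from `K` alone, and then for every `k ≤ K`, `B ≥ B₁`, `L ≥ 1` and `Λ > 0` with
`bareLambda B = Λ/L` (i.e. `B = 2L³/Λ³`) and `Λ·C₀ ≤ 1` the data exist.  With `x = Λ/L`, `ν = linkC B³`, `E_j = idxLevel j`, `D₀ = (E_K − E_0) + 2C₁`: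

  `σ := 3C₁νx²`, `lamlow := ν e^{−E_K x − C₁x²}` (the TOP window floor — below every window member up to `K`), `Γ := e^{2(E_K−E_0) + 4C₁}`
  (`≥ e^{2L((E_K−E_0)x + 2C₁x²)}` as `Lx = Λ ≤ 1`), `τ := C₀'Λ²/L`, `C₀' = Γ(4D₀ + 12C₁ + 6)`, `C := 2Γ(10C₀' + 6C₁ + 8D₀ + 3)`,
  `C₀ := 3C₀' + (2C₀' + 3C₁)/c_gap + 1`.

(Scalar budgets: `dlv_*` in `…PolyakovLiftPScalingDressedBudgets.lean`.)

* ★★ `dressed_level_data` — the statement; its eleven conjuncts are `pscaling_core`'s (D) and (C) hypotheses VERBATIM (binder `i : Fin k`, windows of `i+1`).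

Elementary inequalities only (`1 − u ≤ e^{−u}`, `e^u ≤ 1 + u + u²` for `u ≤ 1`, `ν/2 ≤ λ_j ≤ 2ν` for `j ≤ K` from the window floors/ceilings and
`E_{K+1}x + C₁x² ≤ 1/2`).

HONEST FRAMING: real-inequality bookkeeping at fixed lattice for ONE stub of ONE conditional crux on the femto rung R2b1; nothing here bears on infinite volume,
the continuum limit or the Clay gap.  References: M. Lüscher, NPB 219 (1983) 233 [cite: Luscher1983, §2–§3]; Reed–Simon IV, Thm. XIII.1 [cite: ReedSimonIV1978, Thm. XIII.1].
-/

set_option autoImplicit false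

noncomputable section

open MeasureTheory Filter Topology Real
open Literature.MathematicalPhysics.QuantumFieldTheory
open Literature.MathematicalPhysics.QuantumLattice
open Literature.Analysis.OperatorTheory.YMMatrixModel

namespace Summit.QuantumFields.YangMills.Theorems.FemtoTransferGap.PScal

open Summit.QuantumFields.YangMills.Theorems.FemtoTransferGap

/-- `1 − e^{−u} ≤ u`. [folklore] -/
private theorem one_sub_exp_neg_le' (u : ℝ) : 1 - Real.exp (-u) ≤ u := by
  have := Real.add_one_le_exp (-u)
  linarith

/-- ★★ **The dressed level data (D) and the final currency (C) of `pscaling_core`, from ONE on the cluster windows.**  See the module docstring for the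
dictionary of constants; the eleven conjuncts are the hypotheses `hσ, hlow0, hlow, hΓ, hτ0, hτ1, hup, hlo', hgapτ, hτC, hΩC` of `PScal.pscaling_core` verbatim.
Side conditions: `B ≥ B₁` (ONE's threshold on the windows), `bareLambda B = Λ/L`, `1 ≤ L`, `0 < Λ`, `Λ·C₀ ≤ 1`. [cite: Luscher1983, §2–§3] [cite: ReedSimonIV1978, Thm. XIII.1] -/
theorem dressed_level_data (K : ℕ) (hK : idxLevel K < idxLevel (K + 1)) :
    ∃ C₀ C B₁ : ℝ, 0 < C₀ ∧ 0 ≤ C ∧ 0 < B₁ ∧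
      ∀ (k : ℕ), k ≤ K → ∀ (B : ℝ), B₁ ≤ B → ∀ (L : ℕ), 1 ≤ L → ∀ (Λ : ℝ), 0 < Λ → Λ * C₀ ≤ 1 →
        bareLambda B = Λ / L →
        ∃ σ lamlow Γ τ : ℝ,
          (∀ (i : Fin k) (m : ℕ), winLo ((i : ℕ) + 1) ≤ m → m < winHi ((i : ℕ) + 1) →
              |levelValue su2Rep 1 B m - levelValue su2Rep 1 B ((i : ℕ) + 1)| ≤ σ) ∧
          0 < lamlow ∧
          (∀ (i : Fin k) (m : ℕ), winLo ((i : ℕ) + 1) ≤ m → m < winHi ((i : ℕ) + 1) → lamlow ≤ levelValue su2Rep 1 B m) ∧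
          levelValue su2Rep 1 B 0 ^ (2 * L) ≤ Γ * lamlow ^ (2 * L) ∧
          0 ≤ τ ∧ τ ≤ 1 ∧
          (∀ i : Fin k, Γ * ((levelValue su2Rep 1 B 0 - levelValue su2Rep 1 B ((i : ℕ) + 1)) * Λ ^ 2 + σ) ≤
              τ * levelValue su2Rep 1 B ((i : ℕ) + 1)) ∧
          (∀ i : Fin k, Γ * (σ + levelValue su2Rep 1 B ((i : ℕ) + 1) * Λ ^ 2 / (2 * (L : ℝ) + 1)) ≤
              τ / 2 * levelValue su2Rep 1 B ((i : ℕ) + 1)) ∧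
          (∀ i : Fin k, levelValue su2Rep 1 B (winHi ((i : ℕ) + 1)) ≤ Real.exp (-τ) * levelValue su2Rep 1 B ((i : ℕ) + 1)) ∧
          τ ≤ C * Λ ^ 2 / L ∧
          (1 + Λ ^ 2) * Γ * (σ + (Real.exp τ - 1) * levelValue su2Rep 1 B 0 +
              2 * Real.sqrt (Λ ^ 2) * (Real.exp τ * levelValue su2Rep 1 B 0 - Real.exp (-τ) * lamlow) +
              Real.exp ((2 * (L : ℝ) + 1) * τ) * levelValue su2Rep 1 B 0 * Λ ^ 2 / (2 * (L : ℝ) + 1)) ≤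
            C * (Λ ^ 2 / L) * levelValue su2Rep 1 B 0 := by
  obtain ⟨C₁, cgap, Ctop, x₀, B₁, hC₁, hcgap, -, -, hB₁, hpk⟩ := levels_window K hK
  -- the level constants, made opaque (`E = idxLevel`)
  have hEK0 : idxLevel 0 ≤ idxLevel K := idxLevel_mono (Nat.zero_le K)
  have hE0 : 0 ≤ idxLevel 0 := physLevel_nonneg (by omega)
  have hEK1 : idxLevel K ≤ idxLevel (K + 1) := le_of_lt hK
  have hEmono : Monotone idxLevel := idxLevel_mono
  generalize hEg : idxLevel = E at hK hEK0 hE0 hEK1 hEmono hpk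
  clear hEg
  have hEK : 0 ≤ E K := hE0.trans hEK0
  -- the constants
  obtain ⟨D₀, hD₀def⟩ : ∃ D₀ : ℝ, D₀ = (E K - E 0) + 2 * C₁ := ⟨_, rfl⟩
  have hD₀ : 0 ≤ D₀ := by rw [hD₀def]; linarith
  have hD₀E : E K - E 0 ≤ D₀ := by rw [hD₀def]; linarith
  obtain ⟨Γ, hΓdef⟩ : ∃ Γ : ℝ, Γ = Real.exp (2 * (E K - E 0) + 4 * C₁) := ⟨_, rfl⟩
  have hΓ1 : 1 ≤ Γ := by rw [hΓdef]; exact Real.one_le_exp (by linarith)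
  have hΓ0 : 0 ≤ Γ := zero_le_one.trans hΓ1
  obtain ⟨C₀', hC₀'def⟩ : ∃ C₀' : ℝ, C₀' = Γ * (4 * D₀ + 12 * C₁ + 6) := ⟨_, rfl⟩
  have hC₀'Γ : Γ ≤ C₀' := by
    have h := mul_le_mul_of_nonneg_left (show (1 : ℝ) ≤ 4 * D₀ + 12 * C₁ + 6 by linarith) hΓ0
    rw [mul_one] at h
    rw [hC₀'def]; exact h
  have hC₀' : 0 < C₀' := lt_of_lt_of_le one_pos (hΓ1.trans hC₀'Γ)
  obtain ⟨C₀, hC₀def⟩ : ∃ C₀ : ℝ, C₀ = 3 * C₀' + (2 * C₀' + 3 * C₁) / cgap + 1 := ⟨_, rfl⟩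
  have hfrac : 0 ≤ (2 * C₀' + 3 * C₁) / cgap := div_nonneg (by linarith) hcgap.le
  have hC₀1 : 1 ≤ C₀ := by rw [hC₀def]; linarith
  have hC₀ : 0 < C₀ := lt_of_lt_of_le one_pos hC₀1
  obtain ⟨S₀, hS₀def⟩ : ∃ S₀ : ℝ, S₀ = 10 * C₀' + 6 * C₁ + 8 * D₀ + 3 := ⟨_, rfl⟩
  have hS₀ : 0 ≤ S₀ := by rw [hS₀def]; linarith
  have hS₀C : C₀' ≤ S₀ := by rw [hS₀def]; linarith
  obtain ⟨C, hCdef⟩ : ∃ C : ℝ, C = 2 * Γ * S₀ := ⟨_, rfl⟩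
  have hC : 0 ≤ C := by rw [hCdef]; positivity
  have hCC₀' : C₀' ≤ C := by
    -- C₀' ≤ S₀ ≤ Γ S₀ ≤ 2 Γ S₀
    have h1 : S₀ ≤ Γ * S₀ := by
      have := mul_le_mul_of_nonneg_right hΓ1 hS₀
      rwa [one_mul] at this
    have h2 : 0 ≤ Γ * S₀ := mul_nonneg hΓ0 hS₀
    rw [hCdef]; linarith
  refine ⟨C₀, C, B₁, hC₀, hC, hB₁, fun k hkK B hB L hL Λ hΛ hΛC₀ hxΛ => ?_⟩
  obtain ⟨hx, -, hν, hreg, h0, hW⟩ := hpk B hB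
  clear hpk
  -- make the heavy atoms opaque: `ν = linkC B³`, `x = bareLambda B`, `lam j = levelValue … j`
  generalize hνg : linkC B ^ 3 = ν at hν h0 hW
  generalize hxg : bareLambda B = x at hx hreg hW hxΛ
  generalize hlg : levelValue su2Rep 1 B = lam at h0 hW ⊢
  clear hνg hxg hlg
  -- scalars
  have hLr : (1 : ℝ) ≤ L := by exact_mod_cast hL
  have hL0 : (0 : ℝ) < L := lt_of_lt_of_le one_pos hLr
  have hΛ0 : 0 ≤ Λ := hΛ.le
  have hΛ1 : Λ ≤ 1 := by
    have := mul_le_mul_of_nonneg_left hC₀1 hΛ0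
    linarith
  have hxL : x * L = Λ := by rw [hxΛ]; field_simp
  have hx0 : 0 ≤ x := hx.le
  have hxle : x ≤ Λ := by rw [hxΛ]; exact div_le_self hΛ0 hLr
  have hx1 : x ≤ 1 := hxle.trans hΛ1
  have hxx : x ^ 2 ≤ x := by rw [pow_two]; exact mul_le_of_le_one_left hx0 hx1
  have hxΛ1 : x * Λ ≤ 1 := mul_le_one₀ hx1 hΛ0 hΛ1
  -- `y = Λ²/L = Λ·x`
  obtain ⟨y, hydef⟩ : ∃ y : ℝ, y = Λ ^ 2 / L := ⟨_, rfl⟩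
  have hyx : y = Λ * x := by rw [hydef, hxΛ]; field_simp
  have hy0 : 0 ≤ y := by rw [hyx]; exact mul_nonneg hΛ0 hx0
  have hx2y : x ^ 2 ≤ y := by rw [hyx, pow_two]; exact mul_le_mul_of_nonneg_right hxle hx0
  have hyΛ : y ≤ Λ := by rw [hyx]; exact mul_le_of_le_one_right hΛ0 hx1
  have hy1 : y ≤ 1 := hyΛ.trans hΛ1
  have hyL : Λ ^ 2 / (2 * (L : ℝ) + 1) ≤ y := by
    rw [hydef]
    exact div_le_div_of_nonneg_left (sq_nonneg Λ) hL0 (by linarith)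
  -- side conditions
  have hside1 : 3 * C₀' * Λ ≤ 1 := by
    have h3 : 3 * C₀' ≤ C₀ := by rw [hC₀def]; linarith
    have := mul_le_mul_of_nonneg_right h3 hΛ0
    linarith
  have hside2 : 2 * C₀' * Λ + 3 * C₁ * Λ ≤ cgap := by
    have h1 : (2 * C₀' + 3 * C₁) / cgap ≤ C₀ := by rw [hC₀def]; linarith
    have h2 : Λ * ((2 * C₀' + 3 * C₁) / cgap) ≤ 1 := (mul_le_mul_of_nonneg_left h1 hΛ0).trans hΛC₀
    rw [mul_div_assoc', div_le_one hcgap] at h2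
    linarith
  -- the regularity budget `E_K x + C₁ x² ≤ 1/2`
  have huK : E K * x + C₁ * x ^ 2 ≤ 1 / 2 := by
    have := mul_le_mul_of_nonneg_right hEK1 hx0
    linarith
  have hEx0 : 0 ≤ E K * x := mul_nonneg hEK hx0
  have hC₁x0 : 0 ≤ C₁ * x ^ 2 := mul_nonneg hC₁ (sq_nonneg x)
  have hC₁x : C₁ * x ^ 2 ≤ 1 / 2 := by linarith
  have hexpC : Real.exp (C₁ * x ^ 2) ≤ 2 := by
    have h := Real.abs_exp_sub_one_sub_id_le (x := C₁ * x ^ 2) (by rw [abs_of_nonneg hC₁x0]; linarith)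
    have h' := (abs_le.1 h).2
    have hsq : (C₁ * x ^ 2) ^ 2 ≤ 1 / 4 := by
      rw [pow_two]
      have := mul_le_mul hC₁x hC₁x hC₁x0 (by norm_num)
      linarith
    linarith
  -- the top window floor `fl = ν e^{−E_K x − C₁x²}`
  obtain ⟨fl, hfldef⟩ : ∃ fl : ℝ, fl = ν * Real.exp (-(E K * x) - C₁ * x ^ 2) := ⟨_, rfl⟩
  have hflpos : 0 < fl := by rw [hfldef]; exact mul_pos hν (Real.exp_pos _)
  have hfl_ge : ν / 2 ≤ fl := by
    have h := one_sub_exp_neg_le' (E K * x + C₁ * x ^ 2)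
    have e : -(E K * x + C₁ * x ^ 2) = -(E K * x) - C₁ * x ^ 2 := by ring
    rw [e] at h
    have he : 1 / 2 ≤ Real.exp (-(E K * x) - C₁ * x ^ 2) := by linarith
    have := mul_le_mul_of_nonneg_left he hν.le
    rw [hfldef]; linarith
  have hfl_le : fl ≤ ν := by
    have : Real.exp (-(E K * x) - C₁ * x ^ 2) ≤ 1 := Real.exp_le_one_iff.2 (by linarith)
    have := mul_le_mul_of_nonneg_left this hν.le
    rw [hfldef]; linarith
  -- λ_0
  obtain ⟨lam0, hlam0def⟩ : ∃ lam0 : ℝ, lam0 = lam 0 := ⟨_, rfl⟩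
  have hlam0ν : ν / 2 ≤ lam0 := by rw [hlam0def]; exact h0.1
  have hlam02ν : lam0 ≤ 2 * ν := by rw [hlam0def]; exact h0.2
  have hlam0pos : 0 < lam0 := lt_of_lt_of_le (by linarith) hlam0ν
  have hνlam0 : ν ≤ 2 * lam0 := by linarith
  -- λ_0 − fl ≤ 2 D₀ ν x
  have hdiff0 : lam0 - fl ≤ 2 * D₀ * ν * x := by
    obtain ⟨-, h0u, -⟩ := (hW 0 (Nat.zero_le K)).2.2.1 0 (winLo_le 0) (lt_winHi 0)
    obtain ⟨a, hadef⟩ : ∃ a : ℝ, a = -(E 0 * x) + C₁ * x ^ 2 := ⟨_, rfl⟩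
    obtain ⟨u, hudef⟩ : ∃ u : ℝ, u = (E K - E 0) * x + 2 * C₁ * x ^ 2 := ⟨_, rfl⟩
    have hab : -(E K * x) - C₁ * x ^ 2 = a + -u := by rw [hadef, hudef]; ring
    have hea : Real.exp a ≤ 2 := by
      refine (Real.exp_le_exp.2 ?_).trans hexpC
      rw [hadef]
      have := mul_nonneg hE0 hx0
      linarith
    have hea0 : 0 ≤ Real.exp a := (Real.exp_pos a).le
    have heu : 1 - Real.exp (-u) ≤ u := one_sub_exp_neg_le' u
    have hu0 : 0 ≤ u := by
      rw [hudef]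
      have := mul_nonneg (sub_nonneg.2 hEK0) hx0
      linarith
    have heu0 : 0 ≤ 1 - Real.exp (-u) := by
      have := Real.exp_le_one_iff.2 (neg_nonpos.2 hu0)
      linarith
    have huD : u ≤ D₀ * x := by
      have h1 : 2 * C₁ * x ^ 2 ≤ 2 * C₁ * x := mul_le_mul_of_nonneg_left hxx (by linarith)
      have e : D₀ * x = (E K - E 0) * x + 2 * C₁ * x := by rw [hD₀def]; ring
      rw [hudef]
      linarith
    have hkey : Real.exp a * (1 - Real.exp (-u)) ≤ 2 * (D₀ * x) :=
      (mul_le_mul hea heu heu0 (by norm_num)).trans (by linarith)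
    have h1 : lam0 ≤ ν * Real.exp a := by rw [hlam0def, hadef]; exact h0u
    have h2 : fl = ν * Real.exp a * Real.exp (-u) := by rw [hfldef, hab, Real.exp_add]; ring
    have h3 : ν * Real.exp a - fl = ν * (Real.exp a * (1 - Real.exp (-u))) := by rw [h2]; ring
    have h4 : ν * (Real.exp a * (1 - Real.exp (-u))) ≤ ν * (2 * (D₀ * x)) := mul_le_mul_of_nonneg_left hkey hν.le
    linarith
  -- window facts for an index `j ≤ K`
  have hwin : ∀ j : ℕ, j ≤ K →
      ν / 2 ≤ lam j ∧ lam j ≤ 2 * ν ∧ fl ≤ lam j ∧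
      (∀ m : ℕ, winLo j ≤ m → m < winHi j → fl ≤ lam m ∧ |lam m - lam j| ≤ 3 * C₁ * ν * x ^ 2) ∧
      lam (winHi j) ≤ lam j + 3 * C₁ * ν * x ^ 2 - cgap * ν * x := by
    intro j hj
    obtain ⟨-, -, hw1, -, -, hgapj, -, -⟩ := hW j hj
    have hEj : E j ≤ E K := hEmono hj
    have hEj0 : 0 ≤ E j := hE0.trans (hEmono (Nat.zero_le j))
    have hfloors : fl ≤ ν * Real.exp (-(E j * x) - C₁ * x ^ 2) := by
      rw [hfldef]
      refine mul_le_mul_of_nonneg_left (Real.exp_le_exp.2 ?_) hν.le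
      have := mul_le_mul_of_nonneg_right hEj hx0
      linarith
    obtain ⟨hjl, hju, -⟩ := hw1 j (winLo_le j) (lt_winHi j)
    have hjub : lam j ≤ 2 * ν := by
      have h1 : Real.exp (-(E j * x) + C₁ * x ^ 2) ≤ Real.exp (C₁ * x ^ 2) := by
        refine Real.exp_le_exp.2 ?_
        have := mul_nonneg hEj0 hx0
        linarith
      have h2 := mul_le_mul_of_nonneg_left (h1.trans hexpC) hν.le
      linarith
    have hjlb : fl ≤ lam j := hfloors.trans hjl
    refine ⟨hfl_ge.trans hjlb, hjub, hjlb, fun m hm1 hm2 => ?_, ?_⟩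
    · obtain ⟨hml, -, hms⟩ := hw1 m hm1 hm2
      exact ⟨hfloors.trans hml, hms⟩
    · obtain ⟨-, -, hlos⟩ := hw1 (winLo j) le_rfl (winLo_lt_winHi j)
      have := (abs_le.1 hlos).2
      linarith
  -- τ
  obtain ⟨τ, hτdef⟩ : ∃ τ : ℝ, τ = C₀' * Λ ^ 2 / L := ⟨_, rfl⟩
  have hτy : τ = C₀' * y := by rw [hτdef, hydef]; ring
  have hτ0 : 0 ≤ τ := by rw [hτy]; exact mul_nonneg hC₀'.le hy0
  have hτΛ : τ ≤ C₀' * Λ := by rw [hτy]; exact mul_le_mul_of_nonneg_left hyΛ hC₀'.le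
  have hτ3 : 3 * τ ≤ 1 := by linarith
  have hτ1 : τ ≤ 1 := by linarith
  have h3Lτ : 3 * (L : ℝ) * τ ≤ 1 := by
    have e : 3 * (L : ℝ) * τ = (3 * C₀' * Λ) * Λ := by
      rw [hτdef]; field_simp
    rw [e]
    calc 3 * C₀' * Λ * Λ ≤ 1 * Λ := mul_le_mul_of_nonneg_right hside1 hΛ0
      _ ≤ 1 := by linarith
  have h2L1τ0 : 0 ≤ (2 * (L : ℝ) + 1) * τ := by positivity
  have h2L1τ : (2 * (L : ℝ) + 1) * τ ≤ 1 := by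
    have h1 := mul_nonneg (show (0 : ℝ) ≤ L - 1 by linarith) hτ0
    have e : (2 * (L : ℝ) + 1) * τ = 3 * (L : ℝ) * τ - (L - 1) * τ := by ring
    linarith
  -- index bookkeeping
  have hidx : ∀ i : Fin k, (i : ℕ) + 1 ≤ K := fun i => (Nat.succ_le_of_lt i.isLt).trans hkK
  refine ⟨3 * C₁ * ν * x ^ 2, fl, Γ, τ, ?_, hflpos, ?_, ?_, hτ0, hτ1, ?_, ?_, ?_, ?_, ?_⟩
  · -- hσ
    intro i m hm1 hm2
    exact ((hwin _ (hidx i)).2.2.2.1 m hm1 hm2).2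
  · -- hlow
    intro i m hm1 hm2
    exact ((hwin _ (hidx i)).2.2.2.1 m hm1 hm2).1
  · -- hΓ : λ_0^{2L} ≤ Γ fl^{2L}
    obtain ⟨-, -, -, hw2, -⟩ := hW K le_rfl
    have h := hw2 L
    have hexp : Real.exp (2 * (L : ℝ) * ((E K - E 0) * x + 2 * C₁ * x ^ 2)) ≤ Γ := by
      rw [hΓdef]
      refine Real.exp_le_exp.2 ?_
      have e : 2 * (L : ℝ) * ((E K - E 0) * x + 2 * C₁ * x ^ 2) =
          2 * ((E K - E 0) * (x * L)) + 4 * (C₁ * (x * (x * L))) := by ring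
      rw [e, hxL]
      have h1 : (E K - E 0) * Λ ≤ E K - E 0 := mul_le_of_le_one_right (sub_nonneg.2 hEK0) hΛ1
      have h2 : C₁ * (x * Λ) ≤ C₁ := mul_le_of_le_one_right hC₁ hxΛ1
      linarith
    have hpow : 0 ≤ fl ^ (2 * L) := pow_nonneg hflpos.le _
    rw [← hlam0def] at h ⊢
    rw [← hfldef] at h
    exact h.trans (mul_le_mul_of_nonneg_right hexp hpow)
  · -- hup
    intro i
    obtain ⟨hjν, -, hjl, -, -⟩ := hwin _ (hidx i)
    rw [← hlam0def]
    exact dlv_up_budget hΓ0 hC₁ hD₀ hC₀' hC₀'def hν hy0 hyx hx2y hΛ1 hτy hjν (by linarith)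
  · -- hlo'
    intro i
    obtain ⟨hjν, -, -, -, -⟩ := hwin _ (hidx i)
    exact dlv_lo_budget hΓ0 hC₁ hD₀ hC₀'def hν hy0 hx2y hyL hτy hjν
  · -- hgapτ
    intro i
    obtain ⟨hjν, hj2ν, -, -, hhi⟩ := hwin _ (hidx i)
    exact dlv_gap_budget hC₁ hν hx0 hxle hyx hτy hτ0 hside2 hjν hj2ν hhi
  · -- hτC
    rw [hτdef]
    exact div_le_div_of_nonneg_right (mul_le_mul_of_nonneg_right hCC₀' (sq_nonneg Λ)) hL0.le
  · -- hΩC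
    rw [← hlam0def]
    have hfl0 : fl ≤ lam0 := by rw [hlam0def]; exact (hwin 0 (Nat.zero_le K)).2.2.1
    exact dlv_omega_budget hΓ0 hC₁ hD₀ hC₀' hS₀def hCdef hν hΛ0 hΛ1 hy0 hydef hyx hx2y hyL hlam0ν hflpos hfl0
      hdiff0 hτy hτ0 hτ1 h2L1τ0 h2L1τ

end Summit.QuantumFields.YangMills.Theorems.FemtoTransferGap.PScal

end
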